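import Literature.MathematicalPhysics.QuantumFieldTheory.CurvatureGaussianField
import Literature.MathematicalPhysics.QuantumFieldTheory.Balaban1983to89.B3WTFreeMeasure

/-!
# `SourcedPressureIncrement` (stmt-QuantumFields-22517), line `birth`: the EXACT first `h`-cumulant of the Gaussian
# sourced increment (helper toward the ideator's stub `stub_gauss`)

Helper file for the deciding crux item stmt-QuantumFields-22517
(`Summit.QuantumFields.YangMills.Theses.SourcedPressureJensen.SourcedPressureIncrement`, route `SourcedPressureJensen`;
BC3 birth skeleton `bc/SourcedPressureIncrement_birth.lean` of ideator ym-idea-3, stubs `stub_gauss` (L) + `stub_laplace`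
(XL)).  `stub_gauss` bounds the Gaussian sourced increment
`gaussIncrement D λ h n L = |B_L|⁻¹ log E_γ exp(−h Σ_{x ∈ B_L} A_x A_{x + n e₀})`,
`A_x = (λ/2)|Y(p₁₂(x))|² − (λ/2)·D·C(0)`, of the tree's curvature Gaussian field `γ = curvatureGaussianField 4 D`
(`D` colours) by its first cumulant `−h (λ²D/2) C(n)²` plus `M h² + C n/L`.  This file proves that the FIRST CUMULANT IS
EXACT, with no straddling error:

* `integral_sq_mul_sq` — Isserlis/Wick for squares of two coordinates of the Gaussian field of a positive semidefinite
  kernel `K`: `E[ω_s² ω_t²] = K(s,s) K(t,t) + 2 K(s,t)²` (the tree's four-functional Wick theorem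
  `B3WTFreeMeasure.integral_linF_mul₄` on indicator coefficient functions);
* `integral_colourSq_mul_colourSq` — for the curvature field, `E_γ[|Y_p|² |Y_q|²] = D² C(p,p) C(q,q) + 2 D C(p,q)²`
  (`C = curvatureTwoPoint`, colours uncorrelated), and `integral_colourSq`: `E_γ |Y_p|² = D C(p,p)`;
* `integral_centredColourSq_mul` — `E_γ[((λ/2)|Y_p|² − (λ/2) D C(p,p)) ((λ/2)|Y_q|² − (λ/2) D C(q,q))] = (λ² D/2) C(p,q)²`;
* `gauss_firstCumulant` / `gauss_firstCumulant_sum` — with `p = p₁₂(x)`, `q = p₁₂(x + n e₀)` (stationarity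
  `curvatureTwoPoint_shift`: `C(p,p) = C(q,q) = C(0)`, `C(p,q) = C(n) = curvaturePlaquetteCorr 4 n`):
  `E_γ[A_x A_{x+ne₀}] = (λ²D/2)·C(n)²` for EVERY `x ∈ ℤ⁴`, hence `E_γ[Σ_{x ∈ B} A_x A_{x+ne₀}] = |B|·(λ²D/2)·C(n)²` for every
  finite `B ⊂ ℤ⁴` — written with the integrand of `gaussIncrement` verbatim, so that `d/dh|_{h=0}` of the Gaussian
  sourced free energy per site is exactly `−(λ²D/2) C(n)²`, the coefficient `σ = λ²D/2` of the skeleton's composition.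

RECORD-label rung support (all-`G` leaf `WeakCouplingRates.XiPow`); nothing here bears on the Yang–Mills mass gap, which is
NOT proved by this line.  Isserlis (1918) / Janson, *Gaussian Hilbert Spaces* (1997) Thm 1.28. [folklore]
-/

noncomputable section

open MeasureTheory ProbabilityTheory
open Literature.MathematicalPhysics.QuantumFieldTheory Literature.MathematicalPhysics.QuantumLattice
open Literature.MathematicalPhysics.QuantumFieldTheory.Balaban1983to89.B3WTFreeMeasure

namespace Summit.QuantumFields.YangMills.Cruxes.SourcedPressureIncrement.Birth

/-! ### Isserlis for squares of coordinates of the Gaussian field of a kernel -/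

section Isserlis

variable {ι : Type} [DecidableEq ι] {K : ι → ι → ℝ}

/-- The coordinate `ω ↦ ω s` is the finitely supported linear functional with indicator coefficients on `{s, t}`.
[folklore] -/
theorem linF_pair_indicator_left (s t : ι) (ω : ι → ℝ) :
    linF {s, t} (fun i => if i = s then (1 : ℝ) else 0) ω = ω s := by
  simp [linF, ite_mul, Finset.sum_ite_eq']

/-- The coordinate `ω ↦ ω t` is the finitely supported linear functional with indicator coefficients on `{s, t}`.
[folklore] -/
theorem linF_pair_indicator_right (s t : ι) (ω : ι → ℝ) :
    linF {s, t} (fun i => if i = t then (1 : ℝ) else 0) ω = ω t := by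
  simp [linF, ite_mul, Finset.sum_ite_eq']

/-- The Gram form of two indicator coefficient functions is the kernel entry. [folklore] -/
theorem gram_pair_indicator (s t : ι) {a b : ι} (ha : a ∈ ({s, t} : Finset ι)) (hb : b ∈ ({s, t} : Finset ι)) :
    gram K {s, t} (fun i => if i = a then (1 : ℝ) else 0) (fun i => if i = b then (1 : ℝ) else 0) = K a b := by
  simp [gram, ite_mul, mul_ite, Finset.sum_ite_eq', ha, hb]

/-- **Isserlis / Wick for squares**: for the centred Gaussian field of a positive semidefinite kernel `K`,
`E[ω_s² ω_t²] = K(s,s) K(t,t) + 2 K(s,t)²`. Janson, *Gaussian Hilbert Spaces*, Thm 1.28 (three pairings). [folklore] -/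
theorem integral_sq_mul_sq (hK : IsPosSemidefKernel K) (s t : ι) :
    ∫ ω, ω s ^ 2 * ω t ^ 2 ∂gaussianFieldOfKernel K = K s s * K t t + 2 * K s t ^ 2 := by
  have hs : s ∈ ({s, t} : Finset ι) := by simp
  have ht : t ∈ ({s, t} : Finset ι) := by simp
  have h := integral_linF_mul₄ hK {s, t} (fun i => if i = s then (1 : ℝ) else 0)
    (fun i => if i = s then (1 : ℝ) else 0) (fun i => if i = t then (1 : ℝ) else 0)
    (fun i => if i = t then (1 : ℝ) else 0)
  simp only [linF_pair_indicator_left, linF_pair_indicator_right, gram_pair_indicator s t hs hs,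
    gram_pair_indicator s t ht ht, gram_pair_indicator s t hs ht] at h
  have e : ∀ ω : ι → ℝ, ω s ^ 2 * ω t ^ 2 = ω s * ω s * ω t * ω t := fun ω => by ring
  simp_rw [e]
  rw [h]
  ring

/-- Integrability companion of `integral_sq_mul_sq`. [folklore] -/
theorem integrable_sq_mul_sq (hK : IsPosSemidefKernel K) (s t : ι) :
    Integrable (fun ω : ι → ℝ => ω s ^ 2 * ω t ^ 2) (gaussianFieldOfKernel K) := by
  have h := integrable_linF_mul₄ hK {s, t} (fun i => if i = s then (1 : ℝ) else 0)
    (fun i => if i = s then (1 : ℝ) else 0) (fun i => if i = t then (1 : ℝ) else 0)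
    (fun i => if i = t then (1 : ℝ) else 0)
  simp only [linF_pair_indicator_left, linF_pair_indicator_right] at h
  have e : (fun ω : ι → ℝ => ω s ^ 2 * ω t ^ 2) = fun ω => ω s * ω s * ω t * ω t := funext fun ω => by ring
  rw [e]
  exact h

/-- Second moment of a coordinate: `E[ω_s²] = K(s,s)`. [folklore] -/
theorem integral_sq (hK : IsPosSemidefKernel K) (s : ι) :
    ∫ ω, ω s ^ 2 ∂gaussianFieldOfKernel K = K s s := by
  have h := integral_eval_mul hK s s
  have e : ∀ ω : ι → ℝ, ω s ^ 2 = ω s * ω s := fun ω => by ring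
  simp_rw [e]
  exact h

/-- Integrability companion of `integral_sq`. [folklore] -/
theorem integrable_sq (hK : IsPosSemidefKernel K) (s : ι) :
    Integrable (fun ω : ι → ℝ => ω s ^ 2) (gaussianFieldOfKernel K) := by
  have e : (fun ω : ι → ℝ => ω s ^ 2) = fun ω => ω s * ω s := funext fun ω => by ring
  rw [e]
  exact integrable_eval_mul hK s s

end Isserlis

/-! ### Colour sums of squares of the curvature Gaussian field -/

section Curvature

open Literature.Probability.LatticeModels

variable {d : ℕ}

/-- Integration against the curvature Gaussian field is integration against the Gaussian field of the curvature
covariance kernel on (plaquette, colour) indices (uncurrying). [folklore] -/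
theorem integral_curvatureGaussianField_eq (D : ℕ) (G : (ZdPlaquette d → Fin D → ℝ) → ℝ) :
    ∫ Y, G Y ∂curvatureGaussianField d D =
      ∫ ω, G (fun p a => ω (p, a)) ∂gaussianFieldOfKernel (curvatureCovKernel d D) := by
  rw [curvatureGaussianField, integral_map_equiv]
  rfl

/-- `E_γ |Y_p|² = D · C(p,p)`. [folklore] -/
theorem integral_colourSq (hd : 3 ≤ d) (D : ℕ) (p : ZdPlaquette d) :
    ∫ Y, ∑ a : Fin D, (Y p a) ^ 2 ∂curvatureGaussianField d D = D * curvatureTwoPoint p p := by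
  have hK := isPosSemidefKernel_curvatureCovKernel hd D
  rw [integral_curvatureGaussianField_eq]
  rw [integral_finsetSum _ (fun a _ => integrable_sq hK (p, a))]
  simp only [integral_sq hK, curvatureCovKernel_apply, if_true, Finset.sum_const, Finset.card_univ,
    Fintype.card_fin, nsmul_eq_mul]

/-- Integrability of `|Y_p|²`. [folklore] -/
theorem integrable_colourSq (hd : 3 ≤ d) (D : ℕ) (p : ZdPlaquette d) :
    Integrable (fun Y : ZdPlaquette d → Fin D → ℝ => ∑ a : Fin D, (Y p a) ^ 2) (curvatureGaussianField d D) := by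
  have hK := isPosSemidefKernel_curvatureCovKernel hd D
  rw [curvatureGaussianField]
  refine (integrable_map_equiv _ _).2 ?_
  exact integrable_finsetSum _ fun a _ => integrable_sq hK (p, a)

/-- **`E_γ[|Y_p|² |Y_q|²] = D² C(p,p) C(q,q) + 2 D C(p,q)²`** (Isserlis colour by colour; distinct colours are
uncorrelated). [folklore] -/
theorem integral_colourSq_mul_colourSq (hd : 3 ≤ d) (D : ℕ) (p q : ZdPlaquette d) :
    ∫ Y, (∑ a : Fin D, (Y p a) ^ 2) * (∑ b : Fin D, (Y q b) ^ 2) ∂curvatureGaussianField d D =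
      (D : ℝ) ^ 2 * (curvatureTwoPoint p p * curvatureTwoPoint q q) + 2 * D * curvatureTwoPoint p q ^ 2 := by
  have hK := isPosSemidefKernel_curvatureCovKernel hd D
  rw [integral_curvatureGaussianField_eq]
  simp only [Finset.sum_mul_sum]
  rw [integral_finsetSum _ (fun a _ => integrable_finsetSum _ fun b _ => integrable_sq_mul_sq hK (p, a) (q, b))]
  simp only [integral_finsetSum _ (fun b _ => integrable_sq_mul_sq hK (p, _) (q, b)), integral_sq_mul_sq hK,
    curvatureCovKernel_apply, if_true]
  simp only [Finset.sum_add_distrib, Finset.sum_const, Finset.card_univ, Fintype.card_fin, nsmul_eq_mul, ite_pow,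
    zero_pow two_ne_zero, mul_ite, mul_zero, Finset.sum_ite_eq, Finset.mem_univ, if_true]
  ring

/-- Integrability of `|Y_p|² |Y_q|²`. [folklore] -/
theorem integrable_colourSq_mul_colourSq (hd : 3 ≤ d) (D : ℕ) (p q : ZdPlaquette d) :
    Integrable (fun Y : ZdPlaquette d → Fin D → ℝ => (∑ a : Fin D, (Y p a) ^ 2) * (∑ b : Fin D, (Y q b) ^ 2))
      (curvatureGaussianField d D) := by
  have hK := isPosSemidefKernel_curvatureCovKernel hd D
  rw [curvatureGaussianField]
  refine (integrable_map_equiv _ _).2 ?_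
  have e : ((fun Y : ZdPlaquette d → Fin D → ℝ => (∑ a : Fin D, (Y p a) ^ 2) * (∑ b : Fin D, (Y q b) ^ 2)) ∘
      ⇑(MeasurableEquiv.curry (ZdPlaquette d) (Fin D) ℝ)) =
      fun ω => ∑ a : Fin D, ∑ b : Fin D, ω (p, a) ^ 2 * ω (q, b) ^ 2 := by
    funext ω
    simp only [Function.comp_apply, MeasurableEquiv.coe_curry, Function.curry_apply, Finset.sum_mul_sum]
  rw [e]
  exact integrable_finsetSum _ fun a _ => integrable_finsetSum _ fun b _ => integrable_sq_mul_sq hK (p, a) (q, b)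

/-- **The centred colour squares have product expectation `(λ² D / 2) C(p,q)²`**:
`E_γ[((λ/2)|Y_p|² − (λ/2) D C(p,p)) ((λ/2)|Y_q|² − (λ/2) D C(q,q))] = (λ² D/2) C(p,q)²`. [folklore] -/
theorem integral_centredColourSq_mul (hd : 3 ≤ d) (D : ℕ) (lam : ℝ) (p q : ZdPlaquette d) :
    ∫ Y, (lam / 2 * (∑ a : Fin D, (Y p a) ^ 2) - lam / 2 * D * curvatureTwoPoint p p) *
        (lam / 2 * (∑ a : Fin D, (Y q a) ^ 2) - lam / 2 * D * curvatureTwoPoint q q) ∂curvatureGaussianField d D =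
      lam ^ 2 * D / 2 * curvatureTwoPoint p q ^ 2 := by
  haveI := isProbabilityMeasure_curvatureGaussianField hd D
  set γ := curvatureGaussianField d D with hγ
  set cp : ℝ := lam / 2 * D * curvatureTwoPoint p p with hcp
  set cq : ℝ := lam / 2 * D * curvatureTwoPoint q q with hcq
  have hpt : ∀ Y : ZdPlaquette d → Fin D → ℝ,
      (lam / 2 * (∑ a : Fin D, (Y p a) ^ 2) - cp) * (lam / 2 * (∑ a : Fin D, (Y q a) ^ 2) - cq) =
        ((lam / 2) ^ 2 * ((∑ a : Fin D, (Y p a) ^ 2) * (∑ b : Fin D, (Y q b) ^ 2)) -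
            (lam / 2 * cq) * (∑ a : Fin D, (Y p a) ^ 2)) -
          ((lam / 2 * cp) * (∑ a : Fin D, (Y q a) ^ 2) - cp * cq) := fun Y => by ring
  have h1 : Integrable (fun Y : ZdPlaquette d → Fin D → ℝ =>
      (lam / 2) ^ 2 * ((∑ a : Fin D, (Y p a) ^ 2) * (∑ b : Fin D, (Y q b) ^ 2))) γ :=
    (integrable_colourSq_mul_colourSq hd D p q).const_mul _
  have h2 : Integrable (fun Y : ZdPlaquette d → Fin D → ℝ => (lam / 2 * cq) * (∑ a : Fin D, (Y p a) ^ 2)) γ :=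
    (integrable_colourSq hd D p).const_mul _
  have h3 : Integrable (fun Y : ZdPlaquette d → Fin D → ℝ => (lam / 2 * cp) * (∑ a : Fin D, (Y q a) ^ 2)) γ :=
    (integrable_colourSq hd D q).const_mul _
  have h4 : Integrable (fun _ : ZdPlaquette d → Fin D → ℝ => cp * cq) γ := integrable_const _
  have h12 : Integrable (fun Y : ZdPlaquette d → Fin D → ℝ =>
      (lam / 2) ^ 2 * ((∑ a : Fin D, (Y p a) ^ 2) * (∑ b : Fin D, (Y q b) ^ 2)) -
        (lam / 2 * cq) * (∑ a : Fin D, (Y p a) ^ 2)) γ := h1.sub h2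
  have h34 : Integrable (fun Y : ZdPlaquette d → Fin D → ℝ =>
      (lam / 2 * cp) * (∑ a : Fin D, (Y q a) ^ 2) - cp * cq) γ := h3.sub h4
  simp_rw [hpt]
  rw [integral_sub h12 h34, integral_sub h1 h2, integral_sub h3 h4, integral_const_mul, integral_const_mul,
    integral_const_mul, integral_const, probReal_univ, one_smul, hγ, integral_colourSq_mul_colourSq hd,
    integral_colourSq hd, integral_colourSq hd]
  simp only [hcp, hcq]
  ring

/-- Stationarity: the diagonal two-point number of the `(1,2)`-plaquette at `x` is `C(0)`. [folklore] -/
theorem curvatureTwoPoint_plaquette12_self (hd : 3 ≤ d) (x : Site d) :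
    curvatureTwoPoint (plaquette12 hd x) (plaquette12 hd x) = curvaturePlaquetteCorr hd 0 := by
  have h := curvatureTwoPoint_shift (plaquette12 hd 0) (plaquette12 hd 0) x
  simp only [plaquette12, zero_add] at h
  simp only [plaquette12, curvaturePlaquetteCorr, Pi.single_zero]
  exact h

/-- Stationarity: the two-point number of the `(1,2)`-plaquettes at `x` and `x + n e₀` is `C(n)`. [folklore] -/
theorem curvatureTwoPoint_plaquette12_shift (hd : 3 ≤ d) (x : Site d) (n : ℤ) :
    curvatureTwoPoint (plaquette12 hd x) (plaquette12 hd (x + Pi.single (⟨0, by omega⟩ : Fin d) n)) =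
      curvaturePlaquetteCorr hd n := by
  have h := curvatureTwoPoint_shift (plaquette12 hd 0) (plaquette12 hd (Pi.single (⟨0, by omega⟩ : Fin d) n)) x
  simp only [plaquette12, zero_add] at h
  simp only [plaquette12, curvaturePlaquetteCorr]
  rw [add_comm] at h
  exact h

end Curvature

/-! ### The exact first cumulant of the Gaussian sourced increment (`d = 4`) -/

section FirstCumulant

open Literature.Probability.LatticeModels

/-- **EXACT FIRST `h`-CUMULANT, one site.**  For the curvature Gaussian field on `ℤ⁴` with `D` colours, every
`x ∈ ℤ⁴`, `n : ℕ` and `λ : ℝ`: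
`E_γ[((λ/2)|Y(p₁₂ x)|² − (λ/2) D C(0)) ((λ/2)|Y(p₁₂(x + n e₀))|² − (λ/2) D C(0))] = (λ² D / 2) · C(n)²`
— the summand of the source in `gaussIncrement`, verbatim. [folklore] -/
theorem gauss_firstCumulant (D : ℕ) (lam : ℝ) (n : ℕ) (x : Site 4) :
    ∫ Y, (lam / 2 * (∑ a : Fin D, (Y (plaquette12 (d := 4) (by norm_num) x) a) ^ 2) -
            lam / 2 * D * curvaturePlaquetteCorr (d := 4) (by norm_num) 0) *
          (lam / 2 * (∑ a : Fin D, (Y (plaquette12 (d := 4) (by norm_num) (x + Pi.single (0 : Fin 4) (n : ℤ))) a) ^ 2) -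
            lam / 2 * D * curvaturePlaquetteCorr (d := 4) (by norm_num) 0)
        ∂curvatureGaussianField (d := 4) D =
      lam ^ 2 * D / 2 * (curvaturePlaquetteCorr (d := 4) (by norm_num) (n : ℤ)) ^ 2 := by
  have hd : 3 ≤ 4 := by norm_num
  have h0 : (⟨0, by omega⟩ : Fin 4) = 0 := rfl
  have hp := curvatureTwoPoint_plaquette12_self hd x
  have hq := curvatureTwoPoint_plaquette12_self hd (x + Pi.single (0 : Fin 4) (n : ℤ))
  have hpq := curvatureTwoPoint_plaquette12_shift hd x (n : ℤ)
  rw [h0] at hpq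
  have h := integral_centredColourSq_mul hd D lam (plaquette12 hd x) (plaquette12 hd (x + Pi.single (0 : Fin 4) (n : ℤ)))
  rw [hp, hq, hpq] at h
  exact h

/-- Integrability of the one-site summand of the Gaussian source. [folklore] -/
theorem integrable_gauss_summand (D : ℕ) (lam : ℝ) (n : ℕ) (x : Site 4) :
    Integrable (fun Y : ZdPlaquette 4 → Fin D → ℝ =>
      (lam / 2 * (∑ a : Fin D, (Y (plaquette12 (d := 4) (by norm_num) x) a) ^ 2) -
            lam / 2 * D * curvaturePlaquetteCorr (d := 4) (by norm_num) 0) *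
          (lam / 2 * (∑ a : Fin D, (Y (plaquette12 (d := 4) (by norm_num) (x + Pi.single (0 : Fin 4) (n : ℤ))) a) ^ 2) -
            lam / 2 * D * curvaturePlaquetteCorr (d := 4) (by norm_num) 0))
      (curvatureGaussianField (d := 4) D) := by
  have hd : 3 ≤ 4 := by norm_num
  haveI := isProbabilityMeasure_curvatureGaussianField hd D
  set p := plaquette12 (d := 4) hd x
  set q := plaquette12 (d := 4) hd (x + Pi.single (0 : Fin 4) (n : ℤ))
  set c : ℝ := lam / 2 * D * curvaturePlaquetteCorr (d := 4) hd 0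
  have e : (fun Y : ZdPlaquette 4 → Fin D → ℝ =>
      (lam / 2 * (∑ a : Fin D, (Y p a) ^ 2) - c) * (lam / 2 * (∑ a : Fin D, (Y q a) ^ 2) - c)) =
      fun Y => ((lam / 2) ^ 2 * ((∑ a : Fin D, (Y p a) ^ 2) * (∑ b : Fin D, (Y q b) ^ 2)) -
            (lam / 2 * c) * (∑ a : Fin D, (Y p a) ^ 2)) -
          ((lam / 2 * c) * (∑ a : Fin D, (Y q a) ^ 2) - c * c) := by
    funext Y; ring
  rw [e]
  exact (((integrable_colourSq_mul_colourSq hd D p q).const_mul _).sub ((integrable_colourSq hd D p).const_mul _)).sub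
    (((integrable_colourSq hd D q).const_mul _).sub (integrable_const _))

/-- **EXACT FIRST `h`-CUMULANT, summed over a finite set of sites** (no straddling error, by stationarity of the
infinite-volume Gaussian field): for every finite `B ⊂ ℤ⁴`,
`E_γ[Σ_{x ∈ B} A_x A_{x + n e₀}] = |B| · (λ² D / 2) · C(n)²`, `A_x = (λ/2)|Y(p₁₂ x)|² − (λ/2) D C(0)`.  With `B = B_L`
this is `−d/dh|_{h=0}` of `|B_L| · gaussIncrement D λ h n L` up to sign: the first-order coefficient `σ = λ²D/2` of the
skeleton's composition `SourcedPressureIncrement_of`. [folklore] -/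
theorem gauss_firstCumulant_sum (D : ℕ) (lam : ℝ) (n : ℕ) (B : Finset (Site 4)) :
    ∫ Y, ∑ x ∈ B,
        (lam / 2 * (∑ a : Fin D, (Y (plaquette12 (d := 4) (by norm_num) x) a) ^ 2) -
            lam / 2 * D * curvaturePlaquetteCorr (d := 4) (by norm_num) 0) *
          (lam / 2 * (∑ a : Fin D, (Y (plaquette12 (d := 4) (by norm_num) (x + Pi.single (0 : Fin 4) (n : ℤ))) a) ^ 2) -
            lam / 2 * D * curvaturePlaquetteCorr (d := 4) (by norm_num) 0)
        ∂curvatureGaussianField (d := 4) D =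
      (B.card : ℝ) * (lam ^ 2 * D / 2 * (curvaturePlaquetteCorr (d := 4) (by norm_num) (n : ℤ)) ^ 2) := by
  rw [integral_finsetSum _ (fun x _ => integrable_gauss_summand D lam n x)]
  simp only [gauss_firstCumulant, Finset.sum_const, nsmul_eq_mul]

end FirstCumulant

end Summit.QuantumFields.YangMills.Cruxes.SourcedPressureIncrement.Birth
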